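import Summits.HodgeConjecture.CorCM.WeilFourfoldOfMarkmanPlane
import Summits.HodgeConjecture.CorCM.CyclicSexticFaceWeilTypeCount
import HarnessLib

/-!
# COR-CM — faces of a cyclic sextic CM field: the whole Weil plane of `A_{j₁} ⊞ E` is algebraic (mod Markman)

HONEST FRAMING (cell `pub-hodgecm2` / COR-CM, seat b24 gen 9; COUNT-NEUTRAL — no binder row of
`HOME/BINDER-OWNERS.md` is touched; no case of the Hodge conjecture is proved: the statements are CONDITIONAL on the
displayed named fact `HodgeTheory.Markman2025_weilClasses_algebraic_abelianFourfold`).  Junction of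
`CorCM/WeilFourfoldOfMarkmanPlane.lean` (Weil type of `B ⊞ E` from the type count; whole plane algebraic mod Markman)
with `CorCM/CyclicSexticFaceWeilTypeCount.lean` (the count for the corner pair `(Ψ_{j₁}; Φ₀)` of configuration (F)):
for `K` Galois CM sextic, `σ` of order `6`, `k = K^{⟨σ²⟩}`, a `SumTwo` quadruple `Ψ` (resp. the corners of a rank-four
face `f`) indexed along the pattern of `CyclicSextic.sumTwo_pattern` (F), realisations `B ⊨ (K; Ψ_{j₁})`,
`E ⊨ (k; Φ₀)` and `δ ∈ 𝓞_k` with `δ² = -d`, `0 < d`: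
`weilClassesOf (B ⊞ E) (ι_B(δ) ⊕ ι_E(δ)) 2 d ≤ algebraicClasses (B ⊞ E).X 2` — step L3 of
`HOME/pub-hodgecm2-lit-andre-3/A1-BLUEPRINT.md` in the shape the pull-back step L5 consumes; plus the twin
`WeilFourfold.cupPowOne_mem_weilClassesMinus` / `cupPowOne_mem_weilClassesOf` of `cupPowOne_mem_weilClassesPlus` (both
generators `w_{τ₊} ∈ E₊`, `w_{τ₋} ∈ E₋` of the plane as cup products of `± i√d`-eigenvectors).

THEOREMS ONLY; no `sorry`; axioms `propext`, `Classical.choice`, `Quot.sound`.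

## References
* [Markman2025SurveySecant] E. Markman, arXiv:2509.23403, Thm. 1.2 and §11.5 Step 2 (vendored record).
* [Deligne1982HodgeCycles] P. Deligne (notes by J. S. Milne), LNM 900 (1982), §4 Prop. 4.4, §5 (c).
-/

noncomputable section

namespace Summit.HodgeConjecture.CorCM.WeilFourfold

open CategoryTheory CategoryTheory.Limits
open Literature.AlgebraicGeometry Literature.AlgebraicGeometry.Motives Literature.AlgebraicGeometry.HodgeTheory
open Literature.AlgebraicTopology.SingularHomology

/-- **`v₁ ⌣ ⋯ ⌣ v_{2m} ∈ E₋`** for `(-i√d)`-eigenvectors `vᵢ` of `φ^*` on `H¹(Y)` — the twin of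
`cupPowOne_mem_weilClassesPlus` for the other embedding of `k` (van Geemen: "`⋀^{2n} W^*`" is the `-`-eigenline), so
that BOTH generators `w_{τ₊} ∈ E₊`, `w_{τ₋} ∈ E₋` of the Weil plane are available to the pull-back step.
[cite: vanGeemen1994HodgeAV, 4.9 and proof of Thm. 6.12] -/
theorem cupPowOne_mem_weilClassesMinus {Y : AbelianVariety ℂ} (φ : Y ⟶ Y) {d m : ℕ}
    (w : Fin (2 * m) → complexBetti Y.X 1)
    (hw : ∀ j, w j ∈ Module.End.eigenspace (complexBetti.map φ.hom.hom.hom 1).hom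
      (-(Complex.I * (Real.sqrt d : ℂ)))) :
    cupPowOne ℂ (ComplexPoints Y.X) (2 * m) w ∈ weilClassesMinus Y φ m d := by
  rw [mem_weilClassesMinus_iff]
  intro x y
  change complexBetti.map (x • 𝟙 Y + y • φ).hom.hom.hom (2 * m) (cupPowOne ℂ (ComplexPoints Y.X) (2 * m) w) = _
  rw [complexBetti_map_cupPowOne]
  have e : (fun j => complexBetti.map (x • 𝟙 Y + y • φ).hom.hom.hom 1 (w j)) =
      fun j => ((x : ℂ) - (y : ℂ) * Complex.I * (Real.sqrt d : ℂ)) • w j := by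
    funext j
    rw [complexBetti_map_nsmul_id_add_nsmul_one_of_mem_eigenspace (hw j) x y, mul_neg, ← sub_eq_add_neg,
      ← mul_assoc]
  rw [e, MultilinearMap.map_smul_univ, Finset.prod_const, Finset.card_univ, Fintype.card_fin]

/-- Both Weil generators at once: a cup product of `2m` eigenvectors of `φ^*` for `± i√d` (same sign) lies in the
Weil plane `weilClassesOf Y φ m d = E₊ ⊔ E₋`. [cite: vanGeemen1994HodgeAV, 4.9 and proof of Thm. 6.12] -/
theorem cupPowOne_mem_weilClassesOf {Y : AbelianVariety ℂ} (φ : Y ⟶ Y) {d m : ℕ}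
    (w : Fin (2 * m) → complexBetti Y.X 1) {μ : ℂ}
    (hμ : μ = Complex.I * (Real.sqrt d : ℂ) ∨ μ = -(Complex.I * (Real.sqrt d : ℂ)))
    (hw : ∀ j, w j ∈ Module.End.eigenspace (complexBetti.map φ.hom.hom.hom 1).hom μ) :
    cupPowOne ℂ (ComplexPoints Y.X) (2 * m) w ∈ weilClassesOf Y φ m d := by
  rcases hμ with rfl | rfl
  · exact weilClassesPlus_le_weilClassesOf Y φ m d (cupPowOne_mem_weilClassesPlus φ w hw)
  · exact weilClassesMinus_le_weilClassesOf Y φ m d (cupPowOne_mem_weilClassesMinus φ w hw)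

end Summit.HodgeConjecture.CorCM.WeilFourfold

namespace Summit.HodgeConjecture.CorCM.CyclicSextic

open CategoryTheory CategoryTheory.Limits NumberField
open Literature.AlgebraicGeometry.Motives (CMType AbelianVariety)
open Literature.AlgebraicGeometry.HodgeTheory
open Literature.AlgebraicGeometry.ComplexMultiplication (IsCMTypeRealisation)
open Literature.NumberTheory.ComplexMultiplication (inducedCMType)
open Literature.NumberTheory.Automorphic.PicardCM.CMCode (cmTypeMap)

variable {K : Type} [Field K] [NumberField K] [IsCMField K] [IsGalois ℚ K] (σ : K ≃ₐ[ℚ] K)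

omit [IsCMField K] in
open scoped Classical in
/-- **The whole Weil plane of `B ⊞ E` is algebraic, given Markman's theorem, for the corner pair of configuration
(F).**  With the data of `weilTypeCount_of_pattern` (`K` Galois CM, `[K:ℚ] = 6`, `σ`, the pattern around
`Ψ_{j₁}` and `Φ₀`), realisations `B ⊨ (K; Ψ_{j₁})`, `E ⊨ (k; Φ₀)` and `δ ∈ 𝓞_k` with `δ² = -d`, `0 < d`:
`weilClassesOf (B ⊞ E) (ι_B(δ) ⊕ ι_E(δ)) 2 d ≤ algebraicClasses (B ⊞ E).X 2` — the count feeds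
`WeilFourfold.weilClassesOf_le_algebraicClasses_cmThreefold_biprod_cmCurve` (`[k:ℚ] = 2` by
`finrank_fixedField_sq`).  CONDITIONAL on `Markman2025_weilClasses_algebraic_abelianFourfold`.
[cite: Markman2025SurveySecant, Thm. 1.2 and §11.5 Step 2] [cite: Deligne1982HodgeCycles, §5 (c), §4 Prop. 4.4] -/
theorem weilClassesOf_le_algebraicClasses_of_pattern (hW4 : Markman2025_weilClasses_algebraic_abelianFourfold)
    (h6 : Module.finrank ℚ K = 6) (hσ : orderOf σ = 6)
    (Ψ : Fin 4 → CMType K) (hΨ : SumTwo Ψ) {j₀ j₁ j₂ j₃ : Fin 4} (hnd : [j₀, j₁, j₂, j₃].Nodup)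
    {Φ₀ : CMType (IntermediateField.fixedField (Subgroup.zpowers (σ ^ 2)))}
    (hΦ₀ : Ψ j₀ = inducedCMType (algebraMap (IntermediateField.fixedField (Subgroup.zpowers (σ ^ 2))) K) Φ₀)
    (h2 : Ψ j₂ = cmTypeMap (σ ^ 2).toRingEquiv (Ψ j₁)) (h4 : Ψ j₃ = cmTypeMap (σ ^ 4).toRingEquiv (Ψ j₁))
    {B : AbelianVariety ℂ} {ιB : 𝓞 K →+* End B} {θB : K →+* Module.End ℂ (complexBetti B.X 1)}
    (hB : IsCMTypeRealisation (Ψ j₁) B ιB θB)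
    {E : AbelianVariety ℂ} {ιE : 𝓞 (IntermediateField.fixedField (Subgroup.zpowers (σ ^ 2))) →+* End E}
    {θE : IntermediateField.fixedField (Subgroup.zpowers (σ ^ 2)) →+* Module.End ℂ (complexBetti E.X 1)}
    (hE : IsCMTypeRealisation Φ₀ E ιE θE)
    {δ : 𝓞 (IntermediateField.fixedField (Subgroup.zpowers (σ ^ 2)))} {d : ℕ} (hd : 0 < d)
    (hδ : ((δ : IntermediateField.fixedField (Subgroup.zpowers (σ ^ 2)))) ^ 2 = -(d : _)) :
    weilClassesOf (B ⊞ E)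
        (biprod.map (ιB (RingOfIntegers.mapRingHom
          (algebraMap (IntermediateField.fixedField (Subgroup.zpowers (σ ^ 2))) K) δ)) (ιE δ)) 2 d ≤
      algebraicClasses (B ⊞ E).X 2 :=
  WeilFourfold.weilClassesOf_le_algebraicClasses_cmThreefold_biprod_cmCurve hW4 h6 (finrank_fixedField_sq σ h6 hσ)
    (algebraMap (IntermediateField.fixedField (Subgroup.zpowers (σ ^ 2))) K) hB hE hd hδ
    (weilTypeCount_of_pattern σ hσ Ψ hΨ hnd hΦ₀ h2 h4)

omit [IsCMField K] in
open scoped Classical in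
/-- The same for the corners of a rank-four FACE `f` (`sumTwo_corner`). [cite: Deligne1982HodgeCycles, §5 (c)] -/
theorem weilClassesOf_le_algebraicClasses_face (hW4 : Markman2025_weilClasses_algebraic_abelianFourfold)
    (h6 : Module.finrank ℚ K = 6) (hσ : orderOf σ = 6) (f : Face K)
    {j₀ j₁ j₂ j₃ : Fin 4} (hnd : [j₀, j₁, j₂, j₃].Nodup)
    {Φ₀ : CMType (IntermediateField.fixedField (Subgroup.zpowers (σ ^ 2)))}
    (hΦ₀ : f.corner j₀ =
      inducedCMType (algebraMap (IntermediateField.fixedField (Subgroup.zpowers (σ ^ 2))) K) Φ₀)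
    (h2 : f.corner j₂ = cmTypeMap (σ ^ 2).toRingEquiv (f.corner j₁))
    (h4 : f.corner j₃ = cmTypeMap (σ ^ 4).toRingEquiv (f.corner j₁))
    {B : AbelianVariety ℂ} {ιB : 𝓞 K →+* End B} {θB : K →+* Module.End ℂ (complexBetti B.X 1)}
    (hB : IsCMTypeRealisation (f.corner j₁) B ιB θB)
    {E : AbelianVariety ℂ} {ιE : 𝓞 (IntermediateField.fixedField (Subgroup.zpowers (σ ^ 2))) →+* End E}
    {θE : IntermediateField.fixedField (Subgroup.zpowers (σ ^ 2)) →+* Module.End ℂ (complexBetti E.X 1)}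
    (hE : IsCMTypeRealisation Φ₀ E ιE θE)
    {δ : 𝓞 (IntermediateField.fixedField (Subgroup.zpowers (σ ^ 2)))} {d : ℕ} (hd : 0 < d)
    (hδ : ((δ : IntermediateField.fixedField (Subgroup.zpowers (σ ^ 2)))) ^ 2 = -(d : _)) :
    weilClassesOf (B ⊞ E)
        (biprod.map (ιB (RingOfIntegers.mapRingHom
          (algebraMap (IntermediateField.fixedField (Subgroup.zpowers (σ ^ 2))) K) δ)) (ιE δ)) 2 d ≤
      algebraicClasses (B ⊞ E).X 2 :=
  weilClassesOf_le_algebraicClasses_of_pattern σ hW4 h6 hσ f.corner (sumTwo_corner f) hnd hΦ₀ h2 h4 hB hE hd hδ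

end Summit.HodgeConjecture.CorCM.CyclicSextic

end
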